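import Summits.BirchSwinnertonDyer.BirchSwinnertonDyer.Theorems.CongruentShaFreeCutCensusPTFree

set_option linter.dupNamespace false -- `Summit.BirchSwinnertonDyer.BirchSwinnertonDyer.Theorems.…` (summit = sub)
set_option autoImplicit false

/-! # Route `CongruentShaFreeCut` (rung S2) — the ♯-BDP road with (LB-exist♯) and (LB-bdp♯) FOLDED INTO
ONE ∃∧ statement «ONE admissible tuple `(ι', Ω_K, Ω_p, C, 𝓛)` with interpolation up to `C` AND its value at
𝟙»: the rank-currency plumbing re-proved and the census of crux B in that currency (`p = 2`)

Cell `bsd-cn100`, prover seat `bsd-cn100-transfer` (g11); the S2 / ♯-frame twin of s2b-c3 g7's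
`Theorems/MordellShaFreeCutThreeAdicBDPExistsValue.lean` (S2b, exact frame) — CLAIM posted on STATUS
2026-08-27T00:35:00Z. Supports, does not close, stmt-BirchSwinnertonDyer-19079 (crux A
`RankPosOfTwoSelmerCorankOne`, whose registered line `heegner-field-bdp-triple-upto` v6cp carries the ACTIVE
♯-triple `stub_twoAdicBDPElementExistsUpTo / stub_twoAdicWanDivisibilityUpTo / stub_twoAdicBDPValueAtOneUpTo`
over `…Theorems.CongruentShaFreeCutTwoAdicBDPTripleUpTo`, p450060); serves crux B (stmt-19080) as its second
road. THEOREMS + ONE `@[conjecture] def` (OPEN, nothing asserted); no named fact, no `sorry`.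

WHY. The registered (LB-bdp♯) `TwoAdicBDPValueAtOneUpTo` is an ∀-TUPLE statement (the value formula for
EVERY admissible `(Ω_K, Ω_p, C, 𝓛)` at every `ι'` inducing `v`). What a construction delivers — the cell's
written transplant MEMO-transfer-13 THEOREM 13.1 + (5.3.1) (research-note grade; Castella 2018 Thm. 3.1 +
3.2 / BDP 2013 Thm. 5.13 being the printed shapes at `p ∤ N`) — is ONE tuple WITH its value at `𝟙`; the
∀-form then costs a CHARACTER SUPPLY (sibling `CongruentShaFreeCutBDPUpToRigidityReadings.lean`, LEMMA R:
`twoAdicBDPValueAtOneUpTo_of_frameValue_of_supply`, p478135). This file records, in the kernel, that the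
♯-BDP road NEVER needed more than the one tuple: the plumbing `heegnerNonTorsion_of_linkA_of_bdpTripleUpTo`
(p450060) reads (LB-bdp♯) only at the tuple produced by (LB-exist♯). So:

* §1 `TwoAdicBDPElementExistsWithValueUpTo` — (LB-exist∧bdp♯)∃: for the data of the registered stubs,
  SOME `ι'` inducing `v` and ONE admissible `(Ω_K, Ω_p, C, 𝓛)` (`Ω_K ≠ 0`, `C ≠ 0`,
  `IsBDPLFunctionUpTo C …`) WITH `𝓛(𝟙) = u · c⁻² · (1 − a₂2⁻¹ + [2 ∤ N]2⁻¹)² · (log_ω P)²`, `u ∈ ℂ₂, u ≠ 0`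
  (`@[conjecture] def`, OPEN at the additive prime `2`, nothing asserted);
  `bdpExistsWithValueUpTo_of_exists_of_value` — implied by the registered pair (LB-exist♯) ∧ (LB-bdp♯);
* §2 the rank-currency plumbing RE-PROVED from (LB-exist∧bdp♯)∃ + (LB-wan♯) (p450060's proof with one
  `obtain` instead of two): `heegnerNonTorsion_of_linkA_of_bdpExistsValueUpTo`;
* §3 the census with Link A discharged (`CongruentShaFreeCutCensusPTFree.twoAdicControlOfRankOne_holds`,
  p457436): `heegnerNonTorsionAtTwo_of_bdpExistsValueUpTo` and `cruxB_of_bdpExistsValueUpTo` — **crux B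
  ⟸ (LB-exist∧bdp♯)∃ + (LB-wan♯) + six refereed facts, NOTHING ELSE** (no ∀-tuple quantifier, no supply).

HONEST FRAMING: CONDITIONAL reductions and one NAMED open statement (weaker than the registered pair);
nothing here proves (LB-exist♯), (LB-wan♯), (LB-bdp♯), crux A, crux B, the leaf
`rankOne_twoConverse_congruentNumber`, the congruent number problem or any case of BSD. PARTITION: none —
RANK axis.

[cite: Castella2018, Thm. 3.1 and Thm. 3.2 (shape; nothing asserted at 2 ∣ N)]
[cite: BertoliniDarmonPrasanna2013, Thm. 5.13 (shape of the value at the trivial character)]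
[cite: CastellaGrossiLeeSkinner2022, §5.2 (proof of Thm. 5.2.1), Thm. 5.1.3]
[cite: GrossZagier1986, Thm. I.6.3 with V.§2] -/

noncomputable section

open scoped Classical

namespace Summit.BirchSwinnertonDyer.BirchSwinnertonDyer.Theorems.CongruentShaFreeCutTwoAdicBDPExistsValueUpTo

open PowerSeries WeierstrassCurve NumberField IsDedekindDomain Field Literature.NumberTheory.EllipticCurves
  Literature.NumberTheory.EllipticCurves.ModularForms Literature.NumberTheory.QuadraticFields
  Literature.NumberTheory.EllipticCurves.Castella2018
open Literature.NumberTheory.GaloisRepresentations Literature.NumberTheory.GaloisCohomology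
open Summit.BirchSwinnertonDyer.BirchSwinnertonDyer.Theses.CongruentShaFreeCut
open Summit.BirchSwinnertonDyer.BirchSwinnertonDyer.Theorems.CongruentShaFreeCutTwoAdicLinks
  (TwoAdicControlOfRankOne)
open Summit.BirchSwinnertonDyer.BirchSwinnertonDyer.Theorems.CongruentShaFreeCutTwoAdicBDPTripleUpTo
  (TwoAdicBDPElementExistsUpTo TwoAdicWanDivisibilityUpTo TwoAdicBDPValueAtOneUpTo)
open Summit.BirchSwinnertonDyer.BirchSwinnertonDyer.Theorems.CongruentShaFreeCutOfHeegnerNonTorsion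
  (HeegnerNonTorsionAtTwo analyticRankOne_of_facts_of_heegnerNonTorsion)
open Summit.BirchSwinnertonDyer.BirchSwinnertonDyer.Theorems.CongruentShaFreeCutCensusPTFree
  (twoAdicControlOfRankOne_holds)

/-! ## 1. The folded ♯ statement (OPEN; named, nothing asserted) and its calibration -/

/-- (LB-exist∧bdp♯)∃ — **ONE `2`-adic anticyclotomic BDP tuple UP TO A NONZERO CONSTANT, WITH ITS VALUE AT
THE TRIVIAL CHARACTER**, for the newform `Dt.f` of `E_n` (`n` square-free) over an imaginary quadratic
Heegner field `K` with `2 = v v̄` split: for every reading of a Heegner point `P` of level `N = N(E_n)`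
through an infinite place `w` (`w(P) = heegnerPointComplex Dt H`) and every `e : K → ℚ₂` inducing `v`, there
are an embedding datum `ι' : ℚ̄₂ ≃ ℂ` inducing `v`, CM periods `Ω_K ∈ ℂˣ`, `Ω_p ∈ R₀ˣ`, a constant
`C ∈ ℂ₂ˣ` and `𝓛 ∈ R₀⟦T⟧` with the interpolation property up to `C`, `IsBDPLFunctionUpTo C ι' v κ γ Dt.f Ω_K
Ω_p 𝓛`, AND `𝓛(𝟙) = u · c⁻² · (1 − a₂·2⁻¹ + [2 ∤ N]·2⁻¹)² · (log_ω P)²` for some `u ∈ ℂ₂, u ≠ 0` (`c = Dt.c`,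
`a₂ = (E_n).LFunction 2 = 0`). The CONJUNCTION of the shapes of Castella 2018 Thm. 3.1 (existence) and
Thm. 3.2 / BDP 2013 Thm. 5.13 (value at `𝟙`) for ONE tuple — exactly what MEMO-transfer-13 THEOREM 13.1 +
(5.3.1) write at the additive prime —; weaker than the registered pair (LB-exist♯)
`TwoAdicBDPElementExistsUpTo` ∧ (LB-bdp♯, ∀-tuple) `TwoAdicBDPValueAtOneUpTo`
(`bdpExistsWithValueUpTo_of_exists_of_value`). OPEN at the additive prime `2` (in print only for `p ∤ N`,
`p ≥ 5`, and `p ∥ N`); nothing asserted.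
[cite: Castella2018, Thm. 3.1 and Thm. 3.2 (shape; nothing asserted at 2 ∣ N)]
[cite: BertoliniDarmonPrasanna2013, Thm. 5.13 (shape)] [cite: CastellaHsieh2018, Def. 3.5 and Prop. 3.6 (shape; the constant)] -/
@[conjecture] def TwoAdicBDPElementExistsWithValueUpTo : Prop :=
  ∀ ⦃n : ℕ⦄, Squarefree n →
    ∀ [(congruentNumberCurve n).IsElliptic] [(congruentNumberCurve n).IsGloballyMinimal]
      (K : Type) [Field K] [NumberField K] (N : ℕ) [NeZero N]
      (Dt : ModularParametrizationData (congruentNumberCurve n) N)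
      (H : HeegnerDatum N (NumberField.discr K)) (w : InfinitePlace K) (e : K →+* ℚ_[2])
      (v : HeightOneSpectrum (𝓞 K)) (κ : ZpExtension K 2) (γ : absoluteGaloisGroup K)
      [Fact (κ.IsTopGenerator γ)] (P : ((congruentNumberCurve n).baseChange K).toAffine.Point),
    (congruentNumberCurve n).conductorNorm ℤ = N → IsImaginaryQuadratic K →
    SatisfiesHeegnerHypothesis N K → ((Ideal.span {(2 : ℤ)}).primesOver (𝓞 K)).ncard = 2 →
    ((2 : ℕ) : 𝓞 K) ∈ v.asIdeal → κ.IsAnticyclotomic →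
    WeierstrassCurve.Affine.Point.map w.embedding.toRatAlgHom P = heegnerPointComplex Dt H →
    (∀ k : 𝓞 K, k ∈ v.asIdeal ↔ ‖e (k : K)‖ < 1) →
    ∃ ι' : PadicAlgCl 2 ≃+* ℂ,
      (∀ (w' : InfinitePlace K) (k : 𝓞 K), k ∈ v.asIdeal ↔ ‖ι'.symm (w'.embedding (k : K))‖ < 1) ∧
      ∃ (ΩK : ℂ) (Ωp : (unrIntegers 2)ˣ) (C : ℂ_[2]) (L : UnrSeries 2),
        ΩK ≠ 0 ∧ C ≠ 0 ∧ IsBDPLFunctionUpTo C ι' v κ γ Dt.f ΩK ((Ωp : unrIntegers 2) : ℂ_[2]) L ∧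
        ∃ u : ℂ_[2], u ≠ 0 ∧ L.HasValueAt 0
          (u * algebraMap ℚ_[2] ℂ_[2] (((Dt.c : ℚ_[2])⁻¹) ^ 2 *
            (1 - ((congruentNumberCurve n).LFunction 2 : ℚ_[2]) * (2 : ℚ_[2])⁻¹ +
              (if (2 : ℕ) ∣ N then 0 else (2 : ℚ_[2])⁻¹)) ^ 2 *
            (padicLogOmega (congruentNumberCurve n) 2 e P) ^ 2))

/-- **Calibration: the registered pair (LB-exist♯) ∧ (LB-bdp♯, ∀-tuple) implies (LB-exist∧bdp♯)∃** — take
(LB-exist♯)'s tuple and apply (LB-bdp♯) to it. So the folded statement is AT MOST as strong as the two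
registered ♯-stubs it replaces in the plumbing. [folklore] -/
theorem bdpExistsWithValueUpTo_of_exists_of_value (hE : TwoAdicBDPElementExistsUpTo)
    (hV : TwoAdicBDPValueAtOneUpTo) : TwoAdicBDPElementExistsWithValueUpTo := by
  intro n hn _ _ K _ _ N _ Dt H w e v κ γ _ P hN hK hHN hsplit hv2 hκ hP he
  obtain ⟨ι', hι', ΩK, Ωp, C, L, hΩK, hC, hBDP⟩ := hE hn K N Dt v κ γ hN hK hHN hsplit hv2 hκ
  obtain ⟨u, hu0, hu⟩ :=
    hV hn ι' K N Dt H w e v κ γ P hN hK hHN hsplit hv2 hι' hκ hP he ΩK Ωp C L hΩK hC hBDP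
  exact ⟨ι', hι', ΩK, Ωp, C, L, hΩK, hC, hBDP, u, hu0, hu⟩

/-! ## 2. The rank-currency plumbing of the ♯-BDP road from (LB-exist∧bdp♯)∃ + (LB-wan♯) -/

/-- **Rank-currency plumbing from the folded ♯ statement** (conclusion `HeegnerNonTorsionAtTwo` = that of
the landed ♯ plumbing `heegnerNonTorsion_of_linkA_of_bdpTripleUpTo`, p450060; proof = p450060's with ONE
`obtain` from (LB-exist∧bdp♯)∃ at the Galois-conjugate reading `P' = τ_* P` in place of the two from
(LB-exist♯), (LB-bdp♯)): Kato descends the rank-one data to `K`; Link A (`hA`) gives a generator `F` of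
`char_Λ 𝔛` with `F(0) ≠ 0`; (LB-exist∧bdp♯)∃ supplies `(ι', Ω_K, Ω_p, C, 𝓛)` WITH
`𝓛(𝟙) = u·c⁻²·(…)²·(log_ω P')²`, `u ≠ 0`; (LB-wan♯) along `toUnr : ℤ₂ → R₀` forces `𝓛(𝟙) ≠ 0`; a torsion `P`
would give `log_ω P' = 0`. CONDITIONAL on the named inputs; credits nothing.
[cite: CastellaGrossiLeeSkinner2022, §5.2 (proof of Thm. 5.2.1)]
[cite: Castella2018, proof of Thm. 2.3 with Thm. 3.4 (shape)] [cite: SilvermanAEC2009, IV.6.4 and VII.2.2] -/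
theorem heegnerNonTorsion_of_linkA_of_bdpExistsValueUpTo
    (hKato : ∀ (W : WeierstrassCurve ℚ) [W.IsElliptic] (p : ℕ) [Fact p.Prime],
      kato_finite_of_L_one_ne_zero W p)
    (hA : TwoAdicControlOfRankOne) (hEV : TwoAdicBDPElementExistsWithValueUpTo)
    (hWan : TwoAdicWanDivisibilityUpTo) : HeegnerNonTorsionAtTwo := by
  -- adapted from `CongruentShaFreeCutTwoAdicBDPTripleUpTo.heegnerNonTorsion_of_linkA_of_bdpTripleUpTo` (p450060)
  intro n hsq K _ _ N _ hN hK hHN hH2 hL hrank hsha P hP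
  haveI := isElliptic_congruentNumberCurve hsq.ne_zero
  haveI := isGloballyMinimal_congruentNumberCurve hsq
  -- (0) `2 = v v̄` splits in `K`
  have hsplit : ((Ideal.span {(2 : ℤ)}).primesOver (𝓞 K)).ncard = 2 := by
    simpa using hH2 2 Nat.prime_two (dvd_refl 2)
  -- (1) the rank-one data over `K` (Kato on the twist)
  obtain ⟨hrk, -, hshaK⟩ := AcPConverseLinks.rank_corank_sha_baseChange_of_twist_L_one_ne_zero
    hKato (congruentNumberCurve n) 2 hK hL hrank hsha
  -- (2) the anticyclotomic datum `(κ, γ)`, THE embedding at a degree-one `𝔭 ∋ 2`, `v`, `v̄`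
  obtain ⟨κ, γ, 𝔭, hκ, hγ, h𝔭, he, hf⟩ :=
    Summit.BirchSwinnertonDyer.Rank1Residual.X11b.exists_anticyclotomic_generator_degreeOnePrime
      2 K hK hH2
  haveI : Fact (κ.IsTopGenerator γ) := ⟨hγ⟩
  set ι : K →+* ℚ_[2] := Summit.BirchSwinnertonDyer.Rank1Residual.X11b.embAt K 2 𝔭 h𝔭 he hf
    with hιdef
  set v := Summit.BirchSwinnertonDyer.Rank1Residual.X11b.inducedPlace ι with hvdef
  have hv : ∀ x : 𝓞 K, x ∈ v.asIdeal ↔ ‖ι (x : K)‖ < 1 :=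
    Summit.BirchSwinnertonDyer.Rank1Residual.X11b.mem_inducedPlace_iff ι
  have hv2 : ((2 : ℕ) : 𝓞 K) ∈ v.asIdeal :=
    Summit.BirchSwinnertonDyer.Rank1Residual.X11b.natCast_mem_inducedPlace ι
  obtain ⟨vbar, hvbar, hne⟩ :=
    Summit.BirchSwinnertonDyer.Rank1Residual.X11b.exists_other_prime hH2 v hv2
  -- (3) Link A at this datum: a generator `F` of `char_Λ 𝔛` with `F(0) ≠ 0`
  obtain ⟨m, -, F, hF, hF0, -⟩ :=
    hA hsq K N hN hK hHN hH2 ι v vbar hv hvbar hne κ hκ γ hrk hshaK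
  -- (4) the Heegner datum of `P`; the Galois conjugate `P'` read through THE infinite place `w₀`
  obtain ⟨Dt, H, ιK, hPι⟩ := hP
  obtain ⟨w₀⟩ := (inferInstance : Nonempty (InfinitePlace K))
  haveI : IsGalois ℚ K := by
    haveI : Algebra.IsQuadraticExtension ℚ K := ⟨hK.1⟩
    infer_instance
  obtain ⟨σ, hσ⟩ := ComplexEmbedding.exists_comp_symm_eq_of_comp_eq (k := ℚ) w₀.embedding ιK
    (by ext x; simp)
  set τ : K →+* K := ((σ.symm : K ≃ₐ[ℚ] K) : K →+* K) with hτdef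
  set P' := WeierstrassCurve.Affine.Point.map τ.toRatAlgHom P with hP'def
  have hP' : WeierstrassCurve.Affine.Point.map w₀.embedding.toRatAlgHom P' =
      heegnerPointComplex Dt H := by
    rw [hP'def, WeierstrassCurve.Affine.Point.map_map]
    have hcomp : w₀.embedding.toRatAlgHom.comp τ.toRatAlgHom = ιK.toRatAlgHom := by
      apply AlgHom.ext
      intro x
      have := RingHom.congr_fun hσ x
      simpa [hτdef] using this
    rw [hcomp]
    exact hPι
  -- (5) (LB-exist∧bdp♯)∃ at `(Dt, H, w₀, ι, v, κ, γ, P')`: ONE tuple WITH its value at `𝟙`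
  obtain ⟨ι', hι', ΩK, Ωp, Cst, L, hΩK, hC, hBDP, u, -, hu⟩ :=
    hEV hsq K N Dt H w₀ ι v κ γ P' hN hK hHN hsplit hv2 hκ hP' hv
  -- (6) (LB-wan♯) along the structure map `toUnr : ℤ₂ → R₀` forces `𝓛(0) ≠ 0`
  obtain ⟨k, hk⟩ := hWan hsq ι' K N Dt v vbar κ γ hN hK hHN hsplit hι' hvbar hne hκ ΩK Ωp Cst L hΩK
    hC hBDP (Summit.BirchSwinnertonDyer.Rank1Residual.X11b.Halves.toUnr 2)
    (Summit.BirchSwinnertonDyer.Rank1Residual.X11b.Halves.coe_toUnr 2)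
  have hFmem : F ∈ AcSelmer.XAc.charIdeal ((congruentNumberCurve n).baseChange K) 2 κ vbar ∅ γ := by
    rw [hF]; exact Ideal.mem_span_singleton_self F
  obtain ⟨G, hG⟩ := Ideal.mem_span_singleton'.mp (hk F hFmem)
  have hL0 : PowerSeries.constantCoeff L ≠ 0 := by
    intro h0
    have h1 := congrArg
      (fun S : UnrSeries 2 ↦ ((PowerSeries.constantCoeff S : unrIntegers 2) : ℂ_[2])) hG
    simp only [map_mul, h0, mul_zero, PowerSeries.constantCoeff_C,
      Summit.BirchSwinnertonDyer.Rank1Residual.X11b.CongruenceLimit.constantCoeff_map_apply,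
      Subring.coe_mul, Subring.coe_pow, Subring.coe_zero,
      Summit.BirchSwinnertonDyer.Rank1Residual.X11b.Halves.coe_toUnr] at h1
    have h2 : ((2 : unrIntegers 2) : ℂ_[2]) = (2 : ℂ_[2]) := by norm_cast
    rw [h2] at h1
    have h3 : algebraMap ℚ_[2] ℂ_[2] ((PowerSeries.constantCoeff F : ℤ_[2]) : ℚ_[2]) = 0 := by
      rcases mul_eq_zero.mp h1.symm with h | h
      · exact absurd (pow_eq_zero_iff'.mp h).1 two_ne_zero
      · exact h
    rw [map_eq_zero_iff _ (algebraMap ℚ_[2] ℂ_[2]).injective] at h3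
    exact hF0 (PadicInt.coe_eq_zero.mp h3)
  -- (7) the value at `𝟙` is `u · c⁻² · (…)² · (log_ω P')²`
  have hval := UnrSeries.eq_constantCoeff_of_hasValueAt_zero hu
  -- (8) a torsion `P` makes `P'` torsion and `log_ω P' = 0`, contradicting `𝓛(0) ≠ 0`
  intro hPtor
  have hP'tor : IsOfFinAddOrder P' := by
    rw [hP'def]
    exact AddMonoidHom.isOfFinAddOrder _ hPtor
  have hlog : padicLogOmega (congruentNumberCurve n) 2 ι P' = 0 := by
    unfold padicLogOmega
    rw [AcPConverseLinks.padicLogPoint_formalIndex_smul_eq_zero_of_isOfFinAddOrder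
      (congruentNumberCurve n) 2 ι hP'tor, zero_div]
  apply hL0
  rw [hlog, zero_pow two_ne_zero, mul_zero, map_zero, mul_zero] at hval
  exact_mod_cast hval.symm

/-! ## 3. The census of crux B in the folded ♯ currency (Link A discharged) -/

/-- **Heegner non-torsion at `2` ⟸ Kato + (LB-exist∧bdp♯)∃ + (LB-wan♯)** — the rank-currency plumbing with
Link A DISCHARGED (`CongruentShaFreeCutCensusPTFree.twoAdicControlOfRankOne_holds`, p457436). CONDITIONAL on
Kato's theorem (refereed) and the two research statements; credits nothing beyond the reduction.
[cite: CastellaGrossiLeeSkinner2022, §5.2 (proof of Thm. 5.2.1)] [cite: Kato2004Asterisque, Cor. 14.3 (p. 235)] -/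
theorem heegnerNonTorsionAtTwo_of_bdpExistsValueUpTo
    (hKato : ∀ (W : WeierstrassCurve ℚ) [W.IsElliptic] (p : ℕ) [Fact p.Prime],
      kato_finite_of_L_one_ne_zero W p)
    (hEV : TwoAdicBDPElementExistsWithValueUpTo) (hWan : TwoAdicWanDivisibilityUpTo) :
    HeegnerNonTorsionAtTwo :=
  heegnerNonTorsion_of_linkA_of_bdpExistsValueUpTo hKato twoAdicControlOfRankOne_holds hEV hWan

/-- **KERNEL CENSUS OF CRUX B in the folded ♯ currency: `AnalyticRankOneOfRankOneFiniteShaTwo` ⟸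
(LB-exist∧bdp♯)∃ + (LB-wan♯) + six refereed facts** (`2`-parity, modularity, Hoffstein–Luo, Kato,
existence of Heegner points, Gross–Zagier + Kolyvagin) — NOTHING ELSE: the composition
`CongruentShaFreeCutOfHeegnerNonTorsion.analyticRankOne_of_facts_of_heegnerNonTorsion` (p419056) fed with
`heegnerNonTorsionAtTwo_of_bdpExistsValueUpTo`. Compared with the registered-currency census
`CongruentShaFreeCutCensusPTFree.cruxB_of_bdpTripleUpTo` (p457436): the ∀-tuple (LB-bdp♯) and (LB-exist♯) are
replaced by the single weaker ∃∧ statement; the research content of crux B on the ♯-BDP road is ONE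
construction-with-value (MEMO-transfer-13 Thm 13.1 + (5.3.1), written, reads owed) + ONE main-conjecture
divisibility (LB-wan♯) at the additive prime `2`. CONDITIONAL; credits nothing; BSD untouched.
[cite: CastellaGrossiLeeSkinner2022, §5.2 (proof of Thm. 5.2.1)] [cite: GrossZagier1986, Thm. I.6.3 with V.§2]
[cite: Kato2004Asterisque, Cor. 14.3 (p. 235)] [cite: DokchitserDokchitserAnnals2010, Thm. 1.4] -/
theorem cruxB_of_bdpExistsValueUpTo
    (hpar : ∀ (W : WeierstrassCurve ℚ) [W.IsElliptic] (p : ℕ) [Fact p.Prime], p_parity W p)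
    (hmod : ModularForms.exists_isNewformOf) (hHL : HoffsteinLuo1997_exists_twist_L_one_ne_zero)
    (hKato : ∀ (W : WeierstrassCurve ℚ) [W.IsElliptic] (p : ℕ) [Fact p.Prime],
      kato_finite_of_L_one_ne_zero W p)
    (hHP : ∀ (W : WeierstrassCurve ℚ) (K : Type) [Field K] [NumberField K],
      exists_isHeegnerPoint W K)
    (hGZ : ∀ (W : WeierstrassCurve ℚ) (N : ℕ) [NeZero N] (K : Type) [Field K] [NumberField K],
      analyticRankEK_eq_one_iff_heegner_nonTorsion W N K)
    (hEV : TwoAdicBDPElementExistsWithValueUpTo) (hWan : TwoAdicWanDivisibilityUpTo) :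
    AnalyticRankOneOfRankOneFiniteShaTwo :=
  analyticRankOne_of_facts_of_heegnerNonTorsion hpar hmod hHL hKato hHP hGZ
    (heegnerNonTorsionAtTwo_of_bdpExistsValueUpTo hKato hEV hWan)

end Summit.BirchSwinnertonDyer.BirchSwinnertonDyer.Theorems.CongruentShaFreeCutTwoAdicBDPExistsValueUpTo

end
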